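import Mathlib
import HarnessLib
import Literature.Computability.AlgebraicComplexity.PatternExpressions
import Literature.Computability.AlgebraicComplexity.ValiantClasses
import Literature.Computability.AlgebraicComplexity.ArithCircuitProofs
import Literature.Computability.AlgebraicComplexity.DetInVP
import Literature.Computability.AlgebraicComplexity.DawarWilsenach2025
import Literature.Combinatorics.SimpleGraph.TreeDecomposition
import Summits.ValiantsHypothesis.ValiantsHypothesis.Theorems.MonotoneRestorationMonotoneRestorationQPLinearWidthSaturation

/-!
# Route MonotoneRestoration, crux `MonotoneRestorationQP` (stmt-15886), line `linear-width` —
# `WidthRestorationQP` already FORCES orbit restoration of `Disc² · Disc² · h` for every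
# matrix-symmetric `VP` family `h`

Helper file (`--supports stmt-ValiantsHypothesis-15886`), def-free; sequel of
`Theorems/…LinearWidthSaturation.lean`.  There the width hypothesis `PolylogHomDetermined` of line
`linear-width` was certified to hold, for free, for `D_n · h_n` with
`D_n = det(V(row sums))² · det(V(column sums))²` (`V` = Vandermonde; `det V² = Disc²`) and any
matrix-symmetric `h`.  Here the bookkeeping is completed: `D_n · h_n` is again a matrix-symmetric `VP`
family when `h` is (`isVPFamily_discSq_mul`: the Vandermonde determinant is a product of `n(n-1)/2`
differences of row sums, `Matrix.det_vandermonde`), so the conjecture-grade node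
`WidthRestorationQP` of the line (every matrix-symmetric, polylog-hom-determined `VP` family has
square-symmetric circuits of quasi-polynomial ORBIT size — unfolded verbatim below) yields, with NO width
hypothesis left, square-symmetric circuits of quasi-polynomial orbit size for `D_n · h_n`, for EVERY
matrix-symmetric `VP` family `h` (`widthRestorationQP_forces_discSq_mul`).  This is the precise sense of
the skeleton's remark that degree lifting (`stub_degreeLifting`) "must re-earn the width hypothesis from
`IsVPFamily`": past degree `≈ n²` the graded family `WidthRung d` is a `VP`-wide restoration statement for
the `Disc²·Disc²`-multiples.

Honest label: calibration of a registered stub; no stub closed; VP ≠ VNP not moved.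
-/

-- `Summit.ValiantsHypothesis.ValiantsHypothesis.…` is the tree's mandated namespace (Sub = Summit).
set_option linter.dupNamespace false

noncomputable section

namespace Summit.ValiantsHypothesis.ValiantsHypothesis.Theorems

namespace WidthSaturation

open Literature.Computability.AlgebraicComplexity MvPolynomial Matrix

/-! ### Degree bookkeeping -/

/-- The Vandermonde determinant of polynomials of degree `≤ d` has degree `≤ n·n·d`. [folklore] -/
theorem totalDegree_det_vandermonde_le {σ : Type*} {n : ℕ} (L : Fin n → MvPolynomial σ ℂ) (d : ℕ)
    (hL : ∀ u, (L u).totalDegree ≤ d) : (det (vandermonde L)).totalDegree ≤ n * n * d := by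
  rw [det_vandermonde]
  refine (totalDegree_finsetProd _ _).trans ?_
  calc ∑ i : Fin n, (∏ j ∈ Finset.Ioi i, (L j - L i)).totalDegree
      ≤ ∑ i : Fin n, n * d := Finset.sum_le_sum fun i _ => ?_
    _ = n * n * d := by rw [Finset.sum_const, Finset.card_univ, Fintype.card_fin, smul_eq_mul, mul_assoc]
  refine (totalDegree_finsetProd _ _).trans ?_
  calc ∑ j ∈ Finset.Ioi i, (L j - L i).totalDegree ≤ ∑ j ∈ Finset.Ioi i, d :=
        Finset.sum_le_sum fun j _ => (totalDegree_sub _ _).trans (max_le (hL j) (hL i))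
    _ = (Finset.Ioi i).card * d := by rw [Finset.sum_const, smul_eq_mul]
    _ ≤ n * d := Nat.mul_le_mul_right d ((Finset.card_le_univ _).trans (by simp))

/-- A row sum `Σ_j x_uj` (or a column sum) has degree `≤ 1`. [folklore] -/
theorem totalDegree_linearForm_le {n : ℕ} (v : Fin n → Fin n × Fin n) :
    (∑ j : Fin n, (X (v j) : MvPolynomial (Fin n × Fin n) ℂ)).totalDegree ≤ 1 :=
  (totalDegree_finsetSum _ _).trans (Finset.sup_le fun j _ => (totalDegree_X (R := ℂ) (v j)).le)

/-! ### Complexity bookkeeping -/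

/-- A row sum (or column sum) has complexity `≤ n`. [folklore] -/
theorem complexity_linearForm_le {n : ℕ} (v : Fin n → Fin n × Fin n) :
    complexity (∑ j : Fin n, (X (v j) : MvPolynomial (Fin n × Fin n) ℂ)) ≤ n := by
  refine (complexity_finset_sum_le _ _).trans ?_
  have h0 : ∀ j : Fin n, complexity (X (v j) : MvPolynomial (Fin n × Fin n) ℂ) = 0 :=
    fun j => complexity_X_holds (v j)
  simp [h0]

/-- The Vandermonde determinant of polynomials of complexity `≤ c` has complexity
`≤ n · (n · (2c + 3) + 1)`. [folklore] -/
theorem complexity_det_vandermonde_le {σ : Type*} {n : ℕ} (L : Fin n → MvPolynomial σ ℂ) (c : ℕ)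
    (hL : ∀ u, complexity (L u) ≤ c) :
    complexity (det (vandermonde L)) ≤ n * (n * (2 * c + 3) + 1) := by
  rw [det_vandermonde]
  refine (complexity_finset_prod_le _ _).trans ?_
  have hinner : ∀ i : Fin n, complexity (∏ j ∈ Finset.Ioi i, (L j - L i)) ≤ n * (2 * c + 3) := by
    intro i
    refine (complexity_finset_prod_le _ _).trans ?_
    have hsub : ∀ j, complexity (L j - L i) ≤ 2 * c + 2 := fun j => by
      rw [sub_eq_add_neg]
      calc complexity (L j + -L i) ≤ complexity (L j) + complexity (-L i) + 1 :=
            complexity_add_le_holds _ _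
        _ ≤ c + (c + 1) + 1 := by
            gcongr
            · exact hL j
            · exact (complexity_neg_le _).trans (by simpa using hL i)
        _ = 2 * c + 2 := by ring
    have hcard : (Finset.Ioi i).card ≤ n := (Finset.card_le_univ _).trans (by simp)
    calc ∑ j ∈ Finset.Ioi i, complexity (L j - L i) + (Finset.Ioi i).card
        ≤ ∑ j ∈ Finset.Ioi i, (2 * c + 2) + (Finset.Ioi i).card :=
          Nat.add_le_add_right (Finset.sum_le_sum fun j _ => hsub j) _
      _ = (Finset.Ioi i).card * (2 * c + 3) := by rw [Finset.sum_const, smul_eq_mul]; ring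
      _ ≤ n * (2 * c + 3) := Nat.mul_le_mul_right _ hcard
  calc ∑ i : Fin n, complexity (∏ j ∈ Finset.Ioi i, (L j - L i)) + (Finset.univ : Finset (Fin n)).card
      ≤ ∑ i : Fin n, n * (2 * c + 3) + (Finset.univ : Finset (Fin n)).card :=
        Nat.add_le_add_right (Finset.sum_le_sum fun i _ => hinner i) _
    _ = n * (n * (2 * c + 3) + 1) := by
        rw [Finset.sum_const, Finset.card_univ, Fintype.card_fin, smul_eq_mul]; ring

/-! ### `VP` closure -/

/-- **`Disc(row sums)² · Disc(col sums)² · h` is a `VP` family when `h` is.** [folklore] -/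
theorem isVPFamily_discSq_mul (h : (n : ℕ) → MvPolynomial (Fin n × Fin n) ℂ) (hVP : IsVPFamily h) :
    IsVPFamily fun n =>
      det (vandermonde fun u : Fin n => ∑ j : Fin n, (X (u, j) : MvPolynomial (Fin n × Fin n) ℂ)) ^ 2 *
        det (vandermonde fun v : Fin n => ∑ i : Fin n, (X (i, v) : MvPolynomial (Fin n × Fin n) ℂ)) ^ 2 *
        h n := by
  obtain ⟨⟨hcard, hdeg⟩, hcplx⟩ := hVP
  have hn2 : IsPBounded fun n : ℕ => n * n := IsPBounded.mul_holds IsPBounded.id IsPBounded.id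
  refine ⟨⟨hcard, ?_⟩, ?_⟩
  · -- degree: `≤ 2 n² + 2 n² + deg h`
    refine IsPBounded.mono (IsPBounded.add_holds (IsPBounded.add_holds
      (IsPBounded.mul_holds (IsPBounded.const 2) hn2) (IsPBounded.mul_holds (IsPBounded.const 2) hn2))
      hdeg) fun n => ?_
    have hr := totalDegree_det_vandermonde_le
      (fun u : Fin n => ∑ j : Fin n, (X (u, j) : MvPolynomial (Fin n × Fin n) ℂ)) 1
      (fun u => totalDegree_linearForm_le fun j => (u, j))
    have hc := totalDegree_det_vandermonde_le
      (fun v : Fin n => ∑ i : Fin n, (X (i, v) : MvPolynomial (Fin n × Fin n) ℂ)) 1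
      (fun v => totalDegree_linearForm_le fun i => (i, v))
    refine (totalDegree_mul _ _).trans (Nat.add_le_add ((totalDegree_mul _ _).trans
      (Nat.add_le_add ((totalDegree_pow _ _).trans ?_) ((totalDegree_pow _ _).trans ?_))) le_rfl)
    · simpa using Nat.mul_le_mul_left 2 hr
    · simpa using Nat.mul_le_mul_left 2 hc
  · -- complexity: two Vandermonde determinants, two squares, two products, and `h`
    have hD : IsPBounded fun n : ℕ => n * (n * (2 * n + 3) + 1) :=
      IsPBounded.mul_holds IsPBounded.id (IsPBounded.add_holds (IsPBounded.mul_holds IsPBounded.id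
        (IsPBounded.add_holds (IsPBounded.mul_holds (IsPBounded.const 2) IsPBounded.id)
          (IsPBounded.const 3))) (IsPBounded.const 1))
    have hsq : IsPBounded fun n : ℕ => 2 * (n * (n * (2 * n + 3) + 1)) + 1 :=
      IsPBounded.add_holds (IsPBounded.mul_holds (IsPBounded.const 2) hD) (IsPBounded.const 1)
    refine IsPBounded.mono (IsPBounded.add_holds (IsPBounded.add_holds
      (IsPBounded.add_holds (IsPBounded.add_holds hsq hsq) (IsPBounded.const 1)) hcplx)
      (IsPBounded.const 1)) fun n => ?_
    have hr := complexity_det_vandermonde_le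
      (fun u : Fin n => ∑ j : Fin n, (X (u, j) : MvPolynomial (Fin n × Fin n) ℂ)) n
      (fun u => complexity_linearForm_le fun j => (u, j))
    have hc := complexity_det_vandermonde_le
      (fun v : Fin n => ∑ i : Fin n, (X (i, v) : MvPolynomial (Fin n × Fin n) ℂ)) n
      (fun v => complexity_linearForm_le fun i => (i, v))
    have hsqr : ∀ q : MvPolynomial (Fin n × Fin n) ℂ, complexity (q ^ 2) ≤ 2 * complexity q + 1 :=
      fun q => by rw [pow_two]; exact (complexity_mul_le_holds q q).trans (by omega)
    calc complexity (det (vandermonde fun u : Fin n => ∑ j : Fin n,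
            (X (u, j) : MvPolynomial (Fin n × Fin n) ℂ)) ^ 2 *
          det (vandermonde fun v : Fin n => ∑ i : Fin n, (X (i, v) : MvPolynomial (Fin n × Fin n) ℂ)) ^ 2 *
          h n)
        ≤ complexity (det (vandermonde fun u : Fin n => ∑ j : Fin n,
            (X (u, j) : MvPolynomial (Fin n × Fin n) ℂ)) ^ 2 *
          det (vandermonde fun v : Fin n => ∑ i : Fin n, (X (i, v) : MvPolynomial (Fin n × Fin n) ℂ)) ^ 2) +
          complexity (h n) + 1 := complexity_mul_le_holds _ _
      _ ≤ (complexity (det (vandermonde fun u : Fin n => ∑ j : Fin n,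
            (X (u, j) : MvPolynomial (Fin n × Fin n) ℂ)) ^ 2) +
          complexity (det (vandermonde fun v : Fin n => ∑ i : Fin n,
            (X (i, v) : MvPolynomial (Fin n × Fin n) ℂ)) ^ 2) + 1) + complexity (h n) + 1 := by
          gcongr; exact complexity_mul_le_holds _ _
      _ ≤ ((2 * (n * (n * (2 * n + 3) + 1)) + 1) + (2 * (n * (n * (2 * n + 3) + 1)) + 1) + 1) +
          complexity (h n) + 1 := by
          gcongr
          · exact (hsqr _).trans (by omega)
          · exact (hsqr _).trans (by omega)

/-! ### The forcing -/

/-- **`WidthRestorationQP` forces orbit restoration of `Disc² · Disc² · h` for every matrix-symmetric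
`VP` family `h`.**  The hypothesis is `WidthRestorationQP` of line `linear-width`, unfolded verbatim
(`IsMatrixSymmetric`, `IsVPFamily`, `PolylogHomDetermined` with `HomIndist`/`patternGraph`, `QPOrbitSymm`);
the conclusion is `QPOrbitSymm` of the family `n ↦ det(V(row sums))²·det(V(col sums))²·h n`, with no
width hypothesis on `h`. [folklore] -/
theorem widthRestorationQP_forces_discSq_mul
    (hW : ∀ f : (n : ℕ) → MvPolynomial (Fin n × Fin n) ℂ,
      (∀ (n : ℕ) (σ τ : Equiv.Perm (Fin n)),
        MvPolynomial.rename (fun p : Fin n × Fin n => (σ p.1, τ p.2)) (f n) = f n) →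
      IsVPFamily f →
      (∃ c : ℕ, ∀ (n : ℕ) (A B : Fin n × Fin n → ℂ),
        (∀ (a b : ℕ) (E : Multiset (Fin a × Fin b)),
          Literature.Combinatorics.SimpleGraph.treewidth
            (SimpleGraph.fromRel fun u v : Fin a ⊕ Fin b => ∃ p ∈ E, u = Sum.inl p.1 ∧ v = Sum.inr p.2) <
            (Nat.log 2 n + c) ^ c →
          MvPolynomial.eval A (homPoly E n ℂ) = MvPolynomial.eval B (homPoly E n ℂ)) →
        MvPolynomial.eval A (f n) = MvPolynomial.eval B (f n)) →
      ∃ c : ℕ, ∀ n : ℕ, ∃ (G : Type) (_ : Fintype G)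
        (C : LabelledArithCircuit ℂ (Fin n × Fin n) Unit G),
        C.IsSymmetric (Equiv.Perm (Fin n)) ∧ C.eval (C.output ()) = f n ∧
          C.orbitSize (Equiv.Perm (Fin n)) ≤ 2 ^ ((Nat.log 2 n + c) ^ c))
    (h : (n : ℕ) → MvPolynomial (Fin n × Fin n) ℂ)
    (hsymm : ∀ (n : ℕ) (σ τ : Equiv.Perm (Fin n)),
      MvPolynomial.rename (fun p : Fin n × Fin n => (σ p.1, τ p.2)) (h n) = h n)
    (hVP : IsVPFamily h) :
    ∃ c : ℕ, ∀ n : ℕ, ∃ (G : Type) (_ : Fintype G)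
      (C : LabelledArithCircuit ℂ (Fin n × Fin n) Unit G),
      C.IsSymmetric (Equiv.Perm (Fin n)) ∧
      C.eval (C.output ()) =
        det (vandermonde fun u : Fin n => ∑ j : Fin n, (X (u, j) : MvPolynomial (Fin n × Fin n) ℂ)) ^ 2 *
          det (vandermonde fun v : Fin n => ∑ i : Fin n, (X (i, v) : MvPolynomial (Fin n × Fin n) ℂ)) ^ 2 *
          h n ∧
      C.orbitSize (Equiv.Perm (Fin n)) ≤ 2 ^ ((Nat.log 2 n + c) ^ c) :=
  hW _ (fun n σ τ => by
      simp only [map_mul]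
      rw [rename_discRowSq, rename_discColSq, hsymm n σ τ])
    (isVPFamily_discSq_mul h hVP) (polylogHomDetermined_discSq_mul h hsymm)

end WidthSaturation

end Summit.ValiantsHypothesis.ValiantsHypothesis.Theorems

end
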